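import Literature.Geometry.Lorentzian.WaveConeUniqueness
import Literature.Geometry.Lorentzian.Schloemilch
import Mathlib.Analysis.SpecialFunctions.Complex.Arg
import Mathlib.MeasureTheory.Integral.IntervalIntegral.Periodic
import HarnessLib

/-!
# Plane-wave superpositions: the `2+1` wave equation and exactness outside the light cone

Support file (everything proved, no named facts) for the explicit vacuum spacetime of
`Literature.Geometry.Lorentzian.christodoulou_trapped_surface_formation_holds`.

For a smooth even profile `β : ℝ → ℝ`, the **superposition of plane waves**
`W(T, x) = (2π)⁻¹ ∫₀^{2π} β(T + x₁ cos o + x₂ sin o) do` (Whittaker's representation of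
solutions of the wave equation, Whittaker–Watson §18.61) is smooth, solves the `2+1` wave equation
`□W = 0` identically (`PlaneWave.dalembert_W`, differentiation under the integral sign), is even
in `T`, and has Cauchy data `W(0, x) = S[β](‖x‖)` (Schlömilch's mean `Schloemilch.schS`;
rotation of the angle and the evenness of `β`), `W_T(0, x) = 0` (`β'` is odd)
(`PlaneWave.W_zero`, `PlaneWave.dT_W_zero`). Consequently (**exactness outside the light cone**,
`PlaneWave.W_eq_of_exterior`): if `G` is a smooth function on `ℝ²` which is harmonic on
`{‖x‖ > R₀}` and agrees there with `S[β](‖x‖)`, then `W(T, x) = G(x)` whenever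
`‖x‖ > R₀ + |T|` — the difference `W − G` solves `□ = 0` there with vanishing Cauchy data, and
the domain-of-dependence theorem `WaveCone.eq_zero_of_dalembert_eq_zero` applies.

## References

* E. T. Whittaker, G. N. Watson, *A Course of Modern Analysis*, 4th ed., CUP 1927, §18.61
  (general solution of the wave equation by plane waves) and §11.81. [WhittakerWatson1927]
* L. C. Evans, *Partial Differential Equations*, 2nd ed., AMS 2010, §2.4.3. [Evans2010]
-/

noncomputable section

open Set Filter MeasureTheory intervalIntegral Real
open scoped Topology ContDiff

namespace Literature.Geometry.Lorentzian

namespace PlaneWave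

open Literature.Analysis.FunctionSpaces WaveCone Schloemilch

/-- The phase `ℓ_o(T, x) = T + x₁ cos o + x₂ sin o` of the plane wave in the direction `o`
(linear in `(T, x)`). [cite: WhittakerWatson1927, §18.61] -/
def lin (o : ℝ) (p : ℝ × E2) : ℝ := p.1 + p.2 0 * cos o + p.2 1 * sin o

/-- **Weighted plane-wave superpositions** `(2π)⁻¹ ∫₀^{2π} c(o) β(ℓ_o(T, x)) do`.
[cite: WhittakerWatson1927, §18.61] -/
def Wc (c β : ℝ → ℝ) (p : ℝ × E2) : ℝ := (2 * π)⁻¹ * ∫ o in (0 : ℝ)..2 * π, c o * β (lin o p)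

/-- **The plane-wave superposition** `W(T, x) = (2π)⁻¹ ∫₀^{2π} β(T + x₁ cos o + x₂ sin o) do`.
[cite: WhittakerWatson1927, §18.61] -/
def W (β : ℝ → ℝ) (p : ℝ × E2) : ℝ := Wc (fun _ ↦ 1) β p

/-- Unfolding lemma for `W`. [folklore] -/
theorem W_eq (β : ℝ → ℝ) (p : ℝ × E2) :
    W β p = (2 * π)⁻¹ * ∫ o in (0 : ℝ)..2 * π, β (lin o p) := by
  simp [W, Wc]

/-! ### Linearity and smoothness of the phase -/

/-- The phase is additive in `(T, x)`. [folklore] -/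
theorem lin_add (o : ℝ) (p q : ℝ × E2) : lin o (p + q) = lin o p + lin o q := by
  simp only [lin, Prod.fst_add, Prod.snd_add, PiLp.add_apply]
  ring

/-- The phase is homogeneous in `(T, x)`. [folklore] -/
theorem lin_smul (o : ℝ) (s : ℝ) (p : ℝ × E2) : lin o (s • p) = s * lin o p := by
  simp only [lin, Prod.smul_fst, Prod.smul_snd, PiLp.smul_apply, smul_eq_mul]
  ring

/-- The phase is smooth in `(o, T, x)`. [folklore] -/
theorem contDiff_lin : ContDiff ℝ ∞ (fun q : ℝ × (ℝ × E2) ↦ lin q.1 q.2) := by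
  unfold lin
  have h0 : ContDiff ℝ ∞ (fun q : ℝ × (ℝ × E2) ↦ q.2.2 0) :=
    (EuclideanSpace.proj (0 : Fin 2) : E2 →L[ℝ] ℝ).contDiff.comp (contDiff_snd.comp contDiff_snd)
  have h1 : ContDiff ℝ ∞ (fun q : ℝ × (ℝ × E2) ↦ q.2.2 1) :=
    (EuclideanSpace.proj (1 : Fin 2) : E2 →L[ℝ] ℝ).contDiff.comp (contDiff_snd.comp contDiff_snd)
  exact ((contDiff_fst.comp contDiff_snd).add (h0.mul (contDiff_cos.comp contDiff_fst))).add
    (h1.mul (contDiff_sin.comp contDiff_fst))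

/-- The phase is continuous in `o` for fixed `(T, x)`. [folklore] -/
theorem continuous_lin_left (p : ℝ × E2) : Continuous fun o ↦ lin o p := by
  unfold lin; fun_prop

variable {c β : ℝ → ℝ}

/-- The weighted integrand is smooth. [folklore] -/
theorem contDiff_integrand (hc : ContDiff ℝ ∞ c) (hβ : ContDiff ℝ ∞ β) :
    ContDiff ℝ ∞ (fun q : ℝ × (ℝ × E2) ↦ c q.1 * β (lin q.1 q.2)) :=
  (hc.comp contDiff_fst).mul (hβ.comp contDiff_lin)

/-- **Plane-wave superpositions of smooth profiles are smooth.** [folklore] -/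
theorem contDiff_Wc (hc : ContDiff ℝ ∞ c) (hβ : ContDiff ℝ ∞ β) : ContDiff ℝ ∞ (Wc c β) :=
  contDiff_const.mul (contDiff_parametric_intervalIntegral (contDiff_integrand hc hβ) _ _)

/-- `W` is smooth. [folklore] -/
theorem contDiff_W (hβ : ContDiff ℝ ∞ β) : ContDiff ℝ ∞ (W β) := contDiff_Wc contDiff_const hβ

/-! ### Differentiation under the integral sign -/

/-- The derivative of the integrand in the parameter directions:
`D[(T, x) ↦ c(o) β(ℓ_o(T, x))](v) = c(o) β'(ℓ_o(T, x)) ℓ_o(v)`. [folklore] -/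
theorem fderiv_integrand (hc : ContDiff ℝ ∞ c) (hβ : ContDiff ℝ ∞ β) (o : ℝ) (p v : ℝ × E2) :
    fderiv ℝ (fun q : ℝ × (ℝ × E2) ↦ c q.1 * β (lin q.1 q.2)) (o, p) ((0 : ℝ), v) =
      c o * (deriv β (lin o p) * lin o v) := by
  have hslice : HasFDerivAt (fun q : ℝ × (ℝ × E2) ↦ c q.1 * β (lin q.1 q.2))
      (fderiv ℝ (fun q : ℝ × (ℝ × E2) ↦ c q.1 * β (lin q.1 q.2)) (o, p)) (o, p) :=
    (((contDiff_integrand hc hβ).differentiable (by simp)) (o, p)).hasFDerivAt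
  have hl : HasDerivAt (fun s : ℝ ↦ ((o, p + s • v) : ℝ × (ℝ × E2))) ((0 : ℝ), v) 0 := by
    have h2 : HasDerivAt (fun s : ℝ ↦ p + s • v) v 0 := by
      simpa using ((hasDerivAt_id (0 : ℝ)).smul_const v).const_add p
    exact (hasDerivAt_const (0 : ℝ) o).prodMk h2
  have hline := HasFDerivAt.comp_hasDerivAt_of_eq (x := (0 : ℝ)) hslice hl (by simp)
  have hβd : ∀ x, HasDerivAt β (deriv β x) x := fun x ↦
    ((hβ.differentiable (by simp)) x).hasDerivAt
  have hline' : HasDerivAt (fun s : ℝ ↦ c o * β (lin o (p + s • v)))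
      (c o * (deriv β (lin o p) * lin o v)) 0 := by
    have harg : HasDerivAt (fun s : ℝ ↦ lin o (p + s • v)) (lin o v) 0 := by
      have h1 : (fun s : ℝ ↦ lin o (p + s • v)) = fun s ↦ lin o p + s * lin o v := by
        funext s; rw [lin_add, lin_smul]
      rw [h1]
      simpa using ((hasDerivAt_id (0 : ℝ)).mul_const (lin o v)).const_add (lin o p)
    have h2 := (hβd _).comp (0 : ℝ) harg
    have h3 : lin o (p + (0 : ℝ) • v) = lin o p := by simp
    rw [h3] at h2
    exact h2.const_mul (c o)
  have h := hline.unique hline'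
  simpa [Function.comp_def] using h

/-- **`∂_v ⟨c β⟩ = ⟨c ℓ(v) β'⟩`**: directional derivatives of weighted superpositions. [folklore] -/
theorem fderiv_Wc (hc : ContDiff ℝ ∞ c) (hβ : ContDiff ℝ ∞ β) (p v : ℝ × E2) :
    fderiv ℝ (Wc c β) p v = Wc (fun o ↦ c o * lin o v) (deriv β) p := by
  unfold Wc
  rw [fderiv_const_mul ((differentiable_parametric_intervalIntegral (contDiff_integrand hc hβ)
    (by simp) _ _) p), FunLike.coe_smul, Pi.smul_apply, smul_eq_mul,
    fderiv_parametric_intervalIntegral_apply (contDiff_integrand hc hβ) (by simp)]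
  congr 1
  refine intervalIntegral.integral_congr fun o _ ↦ ?_
  simp only [fderiv_integrand hc hβ]
  ring

/-- The weight `o ↦ c o ℓ_o(v)` is smooth. [folklore] -/
theorem contDiff_weight (hc : ContDiff ℝ ∞ c) (v : ℝ × E2) : ContDiff ℝ ∞ fun o ↦ c o * lin o v :=
  hc.mul (contDiff_lin.comp (contDiff_id.prodMk contDiff_const))

/-- **Second derivatives**: `∂_w ∂_v ⟨c β⟩ = ⟨c ℓ(v) ℓ(w) β''⟩`. [folklore] -/
theorem fderiv_fderiv_Wc (hc : ContDiff ℝ ∞ c) (hβ : ContDiff ℝ ∞ β) (p v w : ℝ × E2) :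
    fderiv ℝ (fun q ↦ fderiv ℝ (Wc c β) q v) p w =
      Wc (fun o ↦ c o * lin o v * lin o w) (deriv (deriv β)) p := by
  have h1 : (fun q ↦ fderiv ℝ (Wc c β) q v) = Wc (fun o ↦ c o * lin o v) (deriv β) :=
    funext fun q ↦ fderiv_Wc hc hβ q v
  rw [h1, fderiv_Wc (contDiff_weight hc v) (contDiff_deriv hβ)]

/-! ### The wave equation -/

/-- The phase of the time direction is `1`. [folklore] -/
@[simp]
theorem lin_time (o : ℝ) : lin o ((1 : ℝ), (0 : E2)) = 1 := by simp [lin]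

/-- The phase of the spatial direction `e_j` is `cos o` resp. `sin o`. [folklore] -/
theorem lin_space (o : ℝ) (j : Fin 2) :
    lin o ((0 : ℝ), EuclideanSpace.single j (1 : ℝ)) = if j = 0 then cos o else sin o := by
  fin_cases j <;> simp [lin]

/-- **Plane-wave superpositions solve the wave equation**: `□W = W_TT − ΔW = 0`, since
`1 − cos² o − sin² o = 0` under the integral. [cite: WhittakerWatson1927, §18.61] -/
theorem dalembert_W (hβ : ContDiff ℝ ∞ β) (p : ℝ × E2) : dalembert (W β) p = 0 := by
  have hc1 : ContDiff ℝ ∞ (fun _ : ℝ ↦ (1 : ℝ)) := contDiff_const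
  unfold dalembert WaveCone.dT WaveCone.dX
  rw [show W β = Wc (fun _ ↦ 1) β from rfl]
  rw [fderiv_fderiv_Wc hc1 hβ, Fin.sum_univ_two, fderiv_fderiv_Wc hc1 hβ, fderiv_fderiv_Wc hc1 hβ]
  simp only [lin_time, lin_space, Fin.one_eq_zero_iff, OfNat.ofNat_ne_one, if_true, if_false, one_mul,
    mul_one]
  unfold Wc
  simp only []
  have hcont : Continuous fun o ↦ deriv (deriv β) (lin o p) :=
    (contDiff_deriv (contDiff_deriv hβ)).continuous.comp (continuous_lin_left p)
  have hi1 : IntervalIntegrable (fun o ↦ (1 : ℝ) * deriv (deriv β) (lin o p)) volume (0 : ℝ) (2 * π) :=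
    (continuous_const.mul hcont).intervalIntegrable _ _
  have hi2 : IntervalIntegrable (fun o ↦ cos o * cos o * deriv (deriv β) (lin o p)) volume (0 : ℝ) (2 * π) :=
    ((continuous_cos.mul continuous_cos).mul hcont).intervalIntegrable _ _
  have hi3 : IntervalIntegrable (fun o ↦ sin o * sin o * deriv (deriv β) (lin o p)) volume (0 : ℝ) (2 * π) :=
    ((continuous_sin.mul continuous_sin).mul hcont).intervalIntegrable _ _
  have hcomb : (∫ o in (0 : ℝ)..2 * π, (1 : ℝ) * deriv (deriv β) (lin o p)) -
      ((∫ o in (0 : ℝ)..2 * π, cos o * cos o * deriv (deriv β) (lin o p)) +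
        ∫ o in (0 : ℝ)..2 * π, sin o * sin o * deriv (deriv β) (lin o p)) = 0 := by
    rw [← intervalIntegral.integral_add hi2 hi3, ← intervalIntegral.integral_sub hi1 (hi2.add hi3)]
    have : ∀ o, (1 : ℝ) * deriv (deriv β) (lin o p) -
        (cos o * cos o * deriv (deriv β) (lin o p) + sin o * sin o * deriv (deriv β) (lin o p)) = 0 := by
      intro o
      have := sin_sq_add_cos_sq o
      linear_combination (-deriv (deriv β) (lin o p)) * this
    simp_rw [this]
    simp
  rw [← mul_add, ← mul_sub, hcomb, mul_zero]

/-! ### Symmetries: evenness in `T`, the Cauchy data -/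

/-- The integrand `o ↦ F(cos o, sin o)`-type functions are `2π`-periodic: here for the phase.
[folklore] -/
theorem lin_add_two_pi (o : ℝ) (p : ℝ × E2) : lin (o + 2 * π) p = lin o p := by
  simp [lin, cos_add_two_pi, sin_add_two_pi]

/-- `ℓ_{o+π}(T, x) = T − (x₁ cos o + x₂ sin o)`, i.e. `ℓ_{o+π}(T, x) = −ℓ_o(−T, x)`. [folklore] -/
theorem lin_add_pi (o : ℝ) (T : ℝ) (x : E2) : lin (o + π) (T, x) = -lin o (-T, x) := by
  simp only [lin, cos_add_pi, sin_add_pi]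
  ring

/-- **`W` is even in `T` for even profiles**: `W(−T, x) = W(T, x)` (replace `o` by `o + π`).
[folklore] -/
theorem W_neg (heven : ∀ s, β (-s) = β s) (T : ℝ) (x : E2) : W β (-T, x) = W β (T, x) := by
  rw [W_eq, W_eq]
  congr 1
  have hper : Function.Periodic (fun o ↦ β (lin o (T, x))) (2 * π) := fun o ↦ by
    simp only [lin_add_two_pi]
  calc ∫ o in (0 : ℝ)..2 * π, β (lin o (-T, x))
      = ∫ o in (0 : ℝ)..2 * π, β (lin (o + π) (T, x)) := by
        refine intervalIntegral.integral_congr fun o _ ↦ ?_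
        simp only [lin_add_pi, heven]
    _ = ∫ o in (0 + π : ℝ)..2 * π + π, β (lin o (T, x)) :=
        intervalIntegral.integral_comp_add_right (fun o ↦ β (lin o (T, x))) π
    _ = ∫ o in (0 : ℝ)..0 + 2 * π, β (lin o (T, x)) := by
        rw [show 2 * π + π = π + 2 * π by ring, zero_add]
        exact hper.intervalIntegral_add_eq π 0
    _ = ∫ o in (0 : ℝ)..2 * π, β (lin o (T, x)) := by rw [zero_add]

/-- **The time derivative of `W` vanishes at `T = 0` for even profiles** (`β'` is odd and
`ℓ_{o+π}(0, x) = −ℓ_o(0, x)`). [folklore] -/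
theorem dT_W_zero (hβ : ContDiff ℝ ∞ β) (heven : ∀ s, β (-s) = β s) (x : E2) :
    dT (W β) ((0 : ℝ), x) = 0 := by
  have hodd : ∀ s, deriv β (-s) = -deriv β s := by
    intro s
    have h1 : deriv (fun y ↦ β (-y)) (-s) = -deriv β (- -s) := by rw [deriv_comp_neg]
    have h2 : (fun y ↦ β (-y)) = β := funext heven
    rw [h2, neg_neg] at h1
    exact h1
  unfold WaveCone.dT
  rw [show W β = Wc (fun _ ↦ 1) β from rfl, fderiv_Wc contDiff_const hβ]
  unfold Wc
  simp only [lin_time, one_mul, mul_one]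
  -- split the circle at `π` and shift the second half by `π`
  set f : ℝ → ℝ := fun o ↦ deriv β (lin o ((0 : ℝ), x)) with hf
  have hfc : Continuous f := (contDiff_deriv hβ).continuous.comp (continuous_lin_left _)
  have hsplit : ∫ o in (0 : ℝ)..2 * π, f o = (∫ o in (0 : ℝ)..π, f o) + ∫ o in π..2 * π, f o :=
    (intervalIntegral.integral_add_adjacent_intervals (hfc.intervalIntegrable _ _)
      (hfc.intervalIntegrable _ _)).symm
  have hshift : ∫ o in π..2 * π, f o = ∫ o in (0 : ℝ)..π, f (o + π) := by
    rw [intervalIntegral.integral_comp_add_right f π, zero_add, show π + π = 2 * π by ring]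
  have hneg : ∀ o, f (o + π) = -f o := by
    intro o
    simp only [hf, lin_add_pi, neg_zero, hodd]
  change (2 * π)⁻¹ * ∫ o in (0 : ℝ)..2 * π, f o = 0
  rw [hsplit, hshift]
  simp_rw [hneg]
  rw [intervalIntegral.integral_neg]
  ring

/-- In polar form: `x₁ cos o + x₂ sin o = ‖x‖ cos(o − α)` with `α` the argument of `x`.
[folklore] -/
theorem lin_zero_eq_norm_mul_cos (x : E2) :
    ∃ α : ℝ, ∀ o, lin o ((0 : ℝ), x) = ‖x‖ * cos (o - α) := by
  by_cases hx : x = 0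
  · refine ⟨0, fun o ↦ ?_⟩
    simp [lin, hx]
  · set z : ℂ := ⟨x 0, x 1⟩ with hz
    have hz0 : z ≠ 0 := by
      intro h
      apply hx
      ext j
      fin_cases j
      · simpa [hz] using congrArg Complex.re h
      · simpa [hz] using congrArg Complex.im h
    have hnorm : ‖z‖ = ‖x‖ := by
      rw [Complex.norm_eq_sqrt_sq_add_sq, EuclideanSpace.norm_eq, Fin.sum_univ_two]
      simp [hz, sq_abs]
    refine ⟨Complex.arg z, fun o ↦ ?_⟩
    have hc : cos (Complex.arg z) = x 0 / ‖x‖ := by rw [Complex.cos_arg hz0, hnorm]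
    have hs : sin (Complex.arg z) = x 1 / ‖x‖ := by rw [Complex.sin_arg, hnorm]
    have hxn : ‖x‖ ≠ 0 := norm_ne_zero_iff.2 hx
    rw [cos_sub, hc, hs, lin]
    simp only [zero_add]
    field_simp

/-- `∫₀^{2π} F(o + a) do = ∫₀^{2π} F(o) do` for `2π`-periodic `F`. [folklore] -/
theorem integral_periodic_shift {F : ℝ → ℝ} (hF : Function.Periodic F (2 * π)) (a : ℝ) :
    ∫ o in (0 : ℝ)..2 * π, F (o + a) = ∫ o in (0 : ℝ)..2 * π, F o := by
  rw [intervalIntegral.integral_comp_add_right F a, zero_add]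
  have := hF.intervalIntegral_add_eq a 0
  rw [zero_add] at this
  rw [show 2 * π + a = a + 2 * π by ring]
  exact this

/-- **The Cauchy datum of `W` is Schlömilch's mean of the profile**:
`W(0, x) = (1/π) ∫₀^π β(‖x‖ sin o) do = S[β](‖x‖)` for even `β` (rotate the angle to the
argument of `x`, `cos o = sin(o + π/2)`, and fold `[π, 2π]` onto `[0, π]` using the evenness).
[cite: WhittakerWatson1927, §11.81] -/
theorem W_zero (hβc : Continuous β) (heven : ∀ s, β (-s) = β s) (x : E2) :
    W β ((0 : ℝ), x) = schS β ‖x‖ := by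
  obtain ⟨α, hα⟩ := lin_zero_eq_norm_mul_cos x
  set r := ‖x‖ with hr
  rw [W_eq, schS]
  -- (1) rotate: `∫ β(r cos(o − α)) = ∫ β(r cos o)`
  have hper1 : Function.Periodic (fun o ↦ β (r * cos o)) (2 * π) := fun o ↦ by
    simp [cos_add_two_pi]
  have h1 : ∫ o in (0 : ℝ)..2 * π, β (lin o ((0 : ℝ), x)) = ∫ o in (0 : ℝ)..2 * π, β (r * cos o) := by
    simp_rw [hα]
    have := integral_periodic_shift hper1 (-α)
    simpa [sub_eq_add_neg] using this
  -- (2) `cos o = sin (o + π/2)`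
  have hper2 : Function.Periodic (fun o ↦ β (r * sin o)) (2 * π) := fun o ↦ by
    simp [sin_add_two_pi]
  have h2 : ∫ o in (0 : ℝ)..2 * π, β (r * cos o) = ∫ o in (0 : ℝ)..2 * π, β (r * sin o) := by
    have := integral_periodic_shift hper2 (π / 2)
    simp_rw [sin_add_pi_div_two] at this
    exact this.symm ▸ rfl
  -- (3) fold `[π, 2π]` onto `[0, π]`
  have hfc : Continuous fun o ↦ β (r * sin o) := hβc.comp (continuous_const.mul continuous_sin)
  have h3 : ∫ o in (0 : ℝ)..2 * π, β (r * sin o) = 2 * ∫ o in (0 : ℝ)..π, β (r * sin o) := by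
    have hsecond : ∫ o in π..2 * π, β (r * sin o) = ∫ o in (0 : ℝ)..π, β (r * sin o) := by
      rw [show (∫ o in π..2 * π, β (r * sin o)) = ∫ o in (0 : ℝ)..π, β (r * sin (o + π)) by
        rw [intervalIntegral.integral_comp_add_right (fun o ↦ β (r * sin o)) π, zero_add,
          show π + π = 2 * π by ring]]
      refine intervalIntegral.integral_congr fun o _ ↦ ?_
      simp only [sin_add_pi, mul_neg, heven]
    rw [← intervalIntegral.integral_add_adjacent_intervals (b := π) (hfc.intervalIntegrable _ _)
      (hfc.intervalIntegrable _ _), hsecond]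
    ring
  rw [h1, h2, h3]
  have hπ : π ≠ 0 := pi_ne_zero
  field_simp

/-! ### Exactness outside the light cone -/

variable {G : E2 → ℝ}

/-- `dT` of a function of `x` alone vanishes. [folklore] -/
theorem dT_comp_snd (hG : ContDiff ℝ ∞ G) (p : ℝ × E2) : dT (fun q : ℝ × E2 ↦ G q.2) p = 0 := by
  unfold WaveCone.dT
  rw [show (fun q : ℝ × E2 ↦ G q.2) = G ∘ Prod.snd from rfl,
    fderiv_comp p ((hG.differentiable (by simp)) _) differentiableAt_snd, fderiv_snd]
  simp

/-- `dX` of a function of `x` alone is the derivative of that function. [folklore] -/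
theorem dX_comp_snd (hG : ContDiff ℝ ∞ G) (j : Fin 2) (p : ℝ × E2) :
    dX (fun q : ℝ × E2 ↦ G q.2) j p = fderiv ℝ G p.2 (EuclideanSpace.single j (1 : ℝ)) := by
  unfold WaveCone.dX
  rw [show (fun q : ℝ × E2 ↦ G q.2) = G ∘ Prod.snd from rfl,
    fderiv_comp p ((hG.differentiable (by simp)) _) differentiableAt_snd, fderiv_snd]
  simp

/-- The d'Alembertian of a function of `x` alone is minus its Laplacian. [folklore] -/
theorem dalembert_comp_snd (hG : ContDiff ℝ ∞ G) (p : ℝ × E2) :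
    dalembert (fun q : ℝ × E2 ↦ G q.2) p =
      -∑ j, fderiv ℝ (fun y ↦ fderiv ℝ G y (EuclideanSpace.single j (1 : ℝ))) p.2
        (EuclideanSpace.single j (1 : ℝ)) := by
  unfold dalembert
  have h1 : dT (fun q : ℝ × E2 ↦ G q.2) = fun _ ↦ 0 := funext fun q ↦ dT_comp_snd hG q
  have h2 : ∀ j, dX (fun q : ℝ × E2 ↦ G q.2) j =
      (fun y ↦ fderiv ℝ G y (EuclideanSpace.single j (1 : ℝ))) ∘ Prod.snd :=
    fun j ↦ funext fun q ↦ dX_comp_snd hG j q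
  rw [h1, fderiv_fun_const, Pi.zero_apply, _root_.zero_apply, zero_sub]
  congr 1
  refine Finset.sum_congr rfl fun j _ ↦ ?_
  have hGj : Differentiable ℝ (fun y ↦ fderiv ℝ G y (EuclideanSpace.single j (1 : ℝ))) :=
    ((hG.fderiv_right (m := ∞) le_rfl).clm_apply contDiff_const).differentiable (by simp)
  rw [h2 j, fderiv_comp p (hGj _) differentiableAt_snd, fderiv_snd]
  simp

/-- `dT` is additive under subtraction of a smooth function. [folklore] -/
theorem dT_sub {u w : ℝ × E2 → ℝ} (hu : ContDiff ℝ ∞ u) (hw : ContDiff ℝ ∞ w) (p : ℝ × E2) :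
    dT (fun q ↦ u q - w q) p = dT u p - dT w p := by
  unfold WaveCone.dT
  rw [fderiv_fun_sub ((hu.differentiable (by simp)) p) ((hw.differentiable (by simp)) p)]
  rfl

/-- `dX` is additive under subtraction. [folklore] -/
theorem dX_sub {u w : ℝ × E2 → ℝ} (hu : ContDiff ℝ ∞ u) (hw : ContDiff ℝ ∞ w) (j : Fin 2)
    (p : ℝ × E2) : dX (fun q ↦ u q - w q) j p = dX u j p - dX w j p := by
  unfold WaveCone.dX
  rw [fderiv_fun_sub ((hu.differentiable (by simp)) p) ((hw.differentiable (by simp)) p)]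
  rfl

/-- The d'Alembertian is additive under subtraction. [folklore] -/
theorem dalembert_sub {u w : ℝ × E2 → ℝ} (hu : ContDiff ℝ ∞ u) (hw : ContDiff ℝ ∞ w) (p : ℝ × E2) :
    dalembert (fun q ↦ u q - w q) p = dalembert u p - dalembert w p := by
  unfold dalembert
  have h1 : dT (fun q ↦ u q - w q) = fun q ↦ dT u q - dT w q := funext fun q ↦ dT_sub hu hw q
  have h2 : ∀ j, dX (fun q ↦ u q - w q) j = fun q ↦ dX u j q - dX w j q :=
    fun j ↦ funext fun q ↦ dX_sub hu hw j q
  rw [h1, fderiv_fun_sub ((contDiff_dT hu).differentiable (by simp) p)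
    ((contDiff_dT hw).differentiable (by simp) p)]
  simp only [h2]
  rw [_root_.sub_apply]
  have h3 : ∀ j, fderiv ℝ (fun q ↦ dX u j q - dX w j q) p ((0 : ℝ), EuclideanSpace.single j (1 : ℝ)) =
      fderiv ℝ (dX u j) p ((0 : ℝ), EuclideanSpace.single j (1 : ℝ)) -
        fderiv ℝ (dX w j) p ((0 : ℝ), EuclideanSpace.single j (1 : ℝ)) := by
    intro j
    rw [fderiv_fun_sub ((contDiff_dX hu j).differentiable (by simp) p)
      ((contDiff_dX hw j).differentiable (by simp) p)]
    rfl
  simp only [h3, Finset.sum_sub_distrib]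
  ring

/-- **Exactness of the plane-wave superposition outside the light cone.** Let `β` be smooth and
even, `G` smooth on `ℝ²`, harmonic on `{‖x‖ > R₀}` and equal there to `S[β](‖x‖)`. Then
`W(T, x) = G(x)` for `‖x‖ > R₀ + |T|`: the difference solves `□ = 0` on `{‖x‖ > R₀}` with zero
Cauchy data there, and `(T, x)` lies in the domain of dependence of that region
(`WaveCone.eq_zero_of_dalembert_eq_zero`; evenness in `T` reduces to `T ≥ 0`).
[cite: Evans2010, §2.4.3, Thm 6] -/
theorem W_eq_of_exterior (hβ : ContDiff ℝ ∞ β) (heven : ∀ s, β (-s) = β s) (hG : ContDiff ℝ ∞ G)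
    {R₀ : ℝ} (hharm : ∀ x : E2, R₀ < ‖x‖ →
      ∑ j, fderiv ℝ (fun y ↦ fderiv ℝ G y (EuclideanSpace.single j (1 : ℝ))) x
        (EuclideanSpace.single j (1 : ℝ)) = 0)
    (hdata : ∀ x : E2, R₀ < ‖x‖ → schS β ‖x‖ = G x) (T : ℝ) (x : E2) (hx : R₀ + |T| < ‖x‖) :
    W β (T, x) = G x := by
  -- reduce to `T ≥ 0`
  wlog hT : 0 ≤ T generalizing T with H
  · have h := H (-T) (by rwa [abs_neg]) (by linarith [le_of_not_ge hT])
    rwa [W_neg heven] at h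
  rcases hT.eq_or_lt with rfl | hTpos
  · rw [W_zero hβ.continuous heven]
    exact hdata x (by simpa using hx)
  · -- the difference `u = W − G`
    set u : ℝ × E2 → ℝ := fun q ↦ W β q - G q.2 with hu_def
    have hWc : ContDiff ℝ ∞ (W β) := contDiff_W hβ
    have hGc : ContDiff ℝ ∞ (fun q : ℝ × E2 ↦ G q.2) := hG.comp contDiff_snd
    have hu : ContDiff ℝ ∞ u := hWc.sub hGc
    rw [abs_of_pos hTpos] at hx
    set ρ : ℝ := (T + (‖x‖ - R₀)) / 2 with hρ
    have hTρ : T < ρ := by rw [hρ]; linarith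
    have hρR : R₀ < ‖x‖ - ρ := by rw [hρ]; linarith
    set U : Set E2 := {y | R₀ < ‖y‖} with hU
    have hUo : IsOpen U := isOpen_lt continuous_const continuous_norm
    have hball : Metric.closedBall x ρ ⊆ U := by
      intro y hy
      rw [Metric.mem_closedBall, dist_eq_norm] at hy
      simp only [hU, mem_setOf_eq]
      have : ‖x‖ ≤ ‖y‖ + ‖y - x‖ := by
        calc ‖x‖ = ‖y - (y - x)‖ := by rw [sub_sub_cancel]
          _ ≤ ‖y‖ + ‖y - x‖ := norm_sub_le _ _
      linarith
    have h := eq_zero_of_dalembert_eq_zero hu hTpos hTρ (fun p hp ↦ ?_) hUo hball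
      (fun y hy ↦ ?_) (fun y hy ↦ ?_)
    · simpa [hu_def, sub_eq_zero] using h
    · -- `□u = ΔG = 0` on the slab piece
      rw [hu_def, dalembert_sub hWc hGc, dalembert_W hβ, dalembert_comp_snd hG, zero_sub, neg_neg]
      exact hharm p.2 (hball hp.2)
    · simp only [hu_def, W_zero hβ.continuous heven, hdata y hy, sub_self]
    · rw [hu_def, dT_sub hWc hGc, dT_W_zero hβ heven, dT_comp_snd hG, sub_zero]

end PlaneWave

end Literature.Geometry.Lorentzian
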